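import Mathlib
import HarnessLib
import HarnessLib.Audit
import Summits.Schanuel.Statement
import HarnessLib.Audit.Status.Attr

/-!
Route: RootDecomp1K

# Route RootDecomp1K «LiouvilleCarving» — Schanuel is Schanuel through a Liouville coordinate plus
Schanuel off every Liouville coordinate

Root decomposition node (cell decomp-schanuel, lens 6 «barrier-complement carving», GEN 7 = round 2
of the gen-6 node; a NEW ROOT route, not a round
of 1G/1C). It suffices to show X = S_L′ ∧ S_D′ where the cut is the DIOPHANTINE CHARACTER OF THE
COORDINATES of the tuple's span: S_L′ =
CoordLiouvilleSchanuel = Schanuel's bound for the ℚ-free tuples z whose ℚ-span contains a number w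
with a Liouville real part or a Liouville
imaginary part (Mathlib `Liouville`), S_D′ = StrictDiophantineSchanuel = Schanuel's bound for the
ℚ-free tuples whose span contains none (the
declared residual). The cut is exact (Schanuel ⟺ S_L′ ∧ S_D′, kernel, node file
g7/LiouvilleCarving.lean `schanuel_iff_pieces₂`; `closes` =
excluded middle on the span predicate, both binders load-bearing) and REFINES round 1 (kernel
lattice: S_L′ → LiouvilleSchanuel → DefectOneSchanuel,
DiophantineSchanuel → S_D′; glued split S_L′ ⟺ LiouvilleSchanuel ∧ MixedLiouvilleSchanuel). It
carves the summit along the complement of the SCOPE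
OF EVERY TRANSCENDENCE MEASURE in the barrier catalogue (B1–B5, H3): measures are statements of
Diophantine type, void on S_L′, where a different
engine — Liouville extraction, i.e. Mahler's class principle made effective — acts, and whose
level-2 storey «real measured number × Liouville
coordinate» is a theorem of the node file for EVERY such pair. No card realised.
Lean: `(∀ (n : ℕ) (z : Fin n → ℂ), LinearIndependent ℚ z → (∃ w ∈ Submodule.span ℚ (Set.range z),
Liouville w.re ∨ Liouville w.im) → (n : Cardinal) ≤ Algebra.trdeg ℚ ↥(IntermediateField.adjoin ℚ
(Set.range z ∪ Set.range (Complex.exp ∘ z)))) ∧ (∀ (n : ℕ) (z : Fin n → ℂ), LinearIndependent ℚ z →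
(¬ ∃ w ∈ Submodule.span ℚ (Set.range z), Liouville w.re ∨ Liouville w.im) → (n : Cardinal) ≤
Algebra.trdeg ℚ ↥(IntermediateField.adjoin ℚ (Set.range z ∪ Set.range (Complex.exp ∘ z))))`

## Assembly
Pure logic: given a ℚ-linearly independent z, either some element of its ℚ-span has a Liouville
coordinate (apply S_L′) or none does (apply
S_D′); `closes (hL : CoordLiouvilleSchanuel) (hD : StrictDiophantineSchanuel) : _root_.Schanuel` in
glue.g7.lean is `intro n z hz; by_cases h : …;
exact hL n z hz h; exact hD n z hz h` (kernel-checked inside the node file as `closes₂`, axioms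
propext / Classical.choice / Quot.sound; both
binders consumed). Conversely Schanuel ⟹ S_L′ and Schanuel ⟹ S_D′ by weakening
(`coordLiouvilleSchanuel_of_schanuel`,
`strictDiophantineSchanuel_of_schanuel`), so the cut is exact (`schanuel_iff_pieces₂`). ROUND 3:
hD's item StrictDiophantineSchanuel is now a SPLIT PARENT — S_D′ ⟸ LinLiouvilleSchanuel ∧
PolyDiophantineSchanuel by the glue item StrictDiophantineSchanuelGlue (excluded middle on
LinLiouville z; kernel strictDiophantineSchanuel_of_pieces₃, node closes₄ : S_L′ → A₃ → B₃ →
Schanuel, exact schanuel_iff_pieces₃); `closes` itself is unchanged.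

ROUND 3 (gen 5 writer / lens-6 gen 8 «LiouvilleCarving ROUND 3»
HOME/decomp-schanuel-lens-6/g8/LiouvilleCarving.lean sha256 761e68ac…, 3702 lines, rc 0 · 0 sorry ·
0 warnings · axioms std (check_node_final.json, check_axioms_audit.json); ADDITIVE over the cleared
g7 node 6cb98b3f… (§§1–10 byte-identical, §§11–14 new); package g8/SHA256SUMS.txt verified by the
writer; critic decomp-schanuel-crit-1 gen 3 CLEARED FOR TYPING 2026-08-30T10:03:08Z (PATH S, Q1; A₃
un-nested, Q2; F2 2/2 with one recorded caveat; standing F2″-1K for round 4; FOREST NOTE R4: 1K ↔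
dormant DiophantineCore); typed by decomp-schanuel-writer-1-g5 IN PLACE, canonical D-0019 PATH S:
rev 2 commit b11c968e `--split StrictDiophantineSchanuel --into children.g8.json (sha 01a97ffc…,
VERBATIM) --glue 'LinLiouvilleSchanuel → PolyDiophantineSchanuel → StrictDiophantineSchanuel'` →
children LinLiouvilleSchanuel = stmt-Schanuel-31986 (A₃, crux r4) / PolyDiophantineSchanuel =
stmt-Schanuel-31987 (B₃, crux r5, NEW DECLARED RESIDUAL) + glue item StrictDiophantineSchanuelGlue =
stmt-Schanuel-31988 (support; PROVED against the live tree in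
g8/prover/RootDecomp1KLinLiouvilleSplit.port.lean, to be landed by census as
Theorems/RootDecomp1KLinLiouvilleSplit.lean); `closes (hL hD)` UNCHANGED (2 binders; hD now the
split parent, claimable at low priority). THE CUT = BARRIER B3's OWN HYPOTHESIS LINE: call z
LIOUVILLE AS A LINEAR FORM (LinLiouville z; «[z] is a Liouville point of ℙⁿ⁻¹») if for every ω some
non-zero h ∈ ℤⁿ has ‖Σ hᵢzᵢ‖ < (1 + Σ|hᵢ|)^{−ω}; A₃ = LinLiouvilleSchanuel := Schanuel's bound at
every ℚ-free LinLiouville z; B₃ = PolyDiophantineSchanuel := Schanuel's bound at every ℚ-free z with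
NO Liouville coordinate in its span (the live 31078 clause verbatim) AND ¬LinLiouville z (a
POLYNOMIAL measure of linear independence). KERNEL (node §§11–13): ¬LinLiouville z →
TechnicalHypothesis z (via the tree-PROVED TechnicalHypothesis.of_lowerBound, DiazGrid) — so EVERY
tuple is LinLiouville or satisfies the Technical Hypothesis of every large-transcendence-degree
criterion (LNM 1752 Ch. 14 Def 2.6 / Thm 2.7), the attackable child A₃ ⊇ ∁(T.H.) («the set on which
no tool acts», DiophantineCore header) BY CONSTRUCTION and the residual B₃ ⊆ (T.H.);
technicalHypothesis_iff_3816 (Iff.rfl: the tree's T.H. is literally the hypothesis of the dormant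
crux SchanuelUnderTH = stmt-Schanuel-3816 of route-Schanuel-DiophantineCore); edges SchanuelUnderTH
3816 ⟹ B₃ (polyDiophantineSchanuel_of_underTH) and A₃ ∧ 3816 ⟹ Schanuel
(schanuel_of_linLiouville_of_underTH) — FOREST NOTE R4: ONE «T.H. side» row {3816, B₃} with the
edge, no merge of routes. STRUCTURE: a ℚ-free LinLiouville pair has real ratio and z₁ = ρ·z₀ with ρ
a real LIOUVILLE number, and conversely (exists_liouville_ratio_of_linLiouville /
linLiouville_of_liouville_ratio); (1, x) is LinLiouville iff x is Liouville (linLiouville_one_iff) —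
round 3 extends round 1's Liouville extraction from the coordinate axes to every real direction
through the tuple (ρ = z₁/z₀ lies in the Schanuel field). EXACTNESS: glue A₃ → B₃ → S_D′ = excluded
middle on LinLiouville z (strictDiophantineSchanuel_of_pieces₃); Schanuel ⟺ S_L′ ∧ A₃ ∧ B₃
(schanuel_iff_pieces₃); S_D′ ⟺ (A₃ on scope S_D′) ∧ B₃ (strictDiophantineSchanuel_iff_pieces₃); both
children ⟸ Schanuel (linLiouvilleSchanuel_of_schanuel, polyDiophantineSchanuel_of_schanuel).
RESIDUAL SHRINKS STRICTLY (kernel residual_shrinks₃, existential Lebesgue witness: for every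
Liouville ℓ, a.e. real x gives a ℚ-free pair (x, ℓx) with no Liouville coordinate in its span that
IS LinLiouville; Mathlib volume_setOf_liouville) and KEEPS the flagships (1, iπ), (iπ, π)
hypothesis-free, (1, e) mod NW (flagship_one_pi_I_in_residual₃; B₃ at (1, iπ) is «e, π algebraically
independent», polyDiophantineSchanuel_at_one_pi_I). DECIDED, HYPOTHESIS-FREE (kernel §13, axioms
std): Schanuel at (π, ℓπ) and (iπ, ℓiπ) for EVERY Liouville ℓ (sb_pi_liouville_mul_pi,
sb_pi_I_liouville_mul_pi_I — on the tree-PROVED Nesterenko–Waldschmidt 1996 measure of π); master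
cell sb_two_of_linLiouville_of_polyMeasure (any θ ∈ ℚ(z, e^z, i) with a length-polynomial
transcendence measure decides Schanuel at a ℚ-free LinLiouville pair); cells through an algebraic
coordinate (mod the tree-proved Waldschmidt 1978 Cor 3.9), the coordinate 1 (mod NW), a logarithm of
an algebraic number (mod W78 Cor 3.7). EXACT LEVEL-2 REDUCTION (linLiouvilleSchanuel_two_iff_dark,
mod W/W78): level 2 of A₃ ⟺ DarkLiouvillePairSchanuel = Schanuel at (t, ρt) with t, e^t
transcendental and algebraically DEPENDENT (e.g. Ωe^Ω = 1), ρ Liouville; sufficient Diophantine leaf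
ExpCurveMahler (IDEA-NEEDED; NW 1996 Thm 1 gives only exp(−c(log H)²) there). Level 1 of A₃ vacuous
(not_linLiouville_one). BC3: A₃'s birth skeleton SHIPPED (g8/bc/birth_section_A3.lean: Measured z
splits A₃ exactly into S1 stub_measuredExtraction — levels ≤ 2 PROVED, size L, provable — and S2
stub_dark; stub probes 2/2 CLEAN); bc7 2/2 CLEAN (+ variant DiophantineFormSchanuel CLEAN). Honest
tags: A₃ WEAKER · ATTACKABLE · INSTRUMENTABLE · IDEA-NEEDED at the dark pairs · N2 (exp not yet
load-bearing in any decided cell); B₃ UNDECIDED · summit-type · ⊆ T.H. · BARRIER(B1, B2, B4–B6 with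
full force) · ⟸ 3816.

ROUND 4 (lens-6 gen 9 «HyperCarving», g9/HyperCarving.lean aba5c91f… 8041 l rc 0 · 0 sorry · axioms
std; critic CLEARED 2026-08-30T13:33:07Z; typed PATH A″ rev 5 617204f1 + rev 6 2547bce3): A₃
LinLiouvilleSchanuel (31986) is CUT BY ONE PREDICATE OF THE TUPLE, «hyper-Liouville as a linear
form» (integer forms small to EVERY exponential order exp(−H^m), H = 1 + Σ|hᵢ|): A₃ ⟺ A₄ʰ
HyperLiouvilleSchanuel (33363, crux r4) ∧ A₄ᵈ FiniteOrderLiouvilleSchanuel (33364, crux r5) (kernel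
linLiouvilleSchanuel_iff_pieces₄; glue = excluded middle on HyperLinLiouville z), and `closes` is
now the flat 4-binder cone S_L′ → A₄ʰ → A₄ᵈ → B₃ → Schanuel (schanuel_iff_pieces₄ exact; S_D′ 31078
⟸ A₄ʰ ∧ A₄ᵈ ∧ B₃, strictDiophantineSchanuelHyperGlue_holds, banked aside together with A₃, both
retained). LEVER (§17h/k): a hyper-Liouville ρ is algebraically independent of any θ carrying a WEAK
measure |P(θ)| ≥ exp(−C_d·len^{k_d}) — the exponential order absorbs any polynomial-in-length loss,
where round 3's mere Liouville ρ needed a POLYNOMIAL measure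
(no_int_relation_of_mvWeakMeasure_hyperLiouville; master cells
sb_two_of_hyperLinLiouville_of_weakMeasure, sb_of_hyperLiouville_ratio_of_mvWeakMeasure); hence A₄ʰ
is DECIDED, with e^z LOAD-BEARING, on the cells (ρ, ρ²), (1, ρ, w) ∀ w, (ρ, …, ρⁿ) ∀ n ≥ 2 for every
real hyper-Liouville ρ and at the NAMED tuple (λ_H, λ_H²) (lambdaH_sq_cell_NW) mod the REGISTERED
fact NesterenkoWaldschmidt1996_thm_5_1 only (p772819; bridge explicitRatExpApprox_of_NW1996),
hypothesis-free through π/iπ (tree-proved NW measure of π); level ≤ 1 vacuous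
(not_hyperLinLiouville_one), level 2 ⟺ DarkHyperPairSchanuel
(hyperLiouvilleSchanuel_two_iff_darkHyper, mod W/W78/NW) with INSTRUMENTABLE leaf DarkWeakMeasure
(weak measure at exp-algebraic points: NW 1996 Thm 1 + root-closeness bookkeeping). A₄ᵈ = the
residual OF THE LIOUVILLE SECTOR: UNDECIDED · IDEA-NEEDED (a SUM-form approximation measure for
e^{p/q}; print has the product form) · first open cell (ℓ_b, ℓ_b²), ℓ_b = Σ b^{−k!}, NAMED and
certified hypothesis-free (liouvilleNumber_sq_cell); fail-alone worlds on both sides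
(failAlone_worlds₄: A₄ʰ silent at (ℓ_b, ℓ_b²), A₄ᵈ silent at (λ_H, λ_H²)). B₃
PolyDiophantineSchanuel (31987) stays THE declared residual of the route (one per route). Honest
tags: A₄ʰ NEW · WEAKER · ATTACKABLE · INSTRUMENTABLE · birth skeleton S1ʷ/S2ʷ shipped; A₄ᵈ NEW ·
WEAKER · UNDECIDED · IDEA-NEEDED; nothing here proves Schanuel.

Rationale: WHY THIS LINE. ROUND 3: ROUND 3 (lens-6 g8): the residual S_D′ is cut along barrier B3's own
hypothesis line — Liouville LINEAR FORMS of the tuple (projective Liouville points; attackable by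
the same Liouville-extraction lever along the direction ρ = z₁/z₀ ∈ ℚ(z)) vs a polynomial measure of
linear independence (⊂ the Technical Hypothesis of every large-transcendence-degree criterion
[corpus:book:nesterenko2001 p.248 Def 2.6 / Thm 2.7, p.249 L27]; [corpus:book:chudnovsky1984 p.20
eq. (2)]); kernel edge to the dormant route DiophantineCore: SchanuelUnderTH 3816 ⟹ B₃, A₃ ∧ 3816 ⟹
Schanuel. Earlier — Mechanism: a transcendence MEASURE for a sub-tuple that is POLYNOMIAL IN THE
LENGTH at each fixed degree (`PolyMeasure θ`: 1 ≤ C·len(P)^τ·|P(θ)|,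
i.e. θ is a Mahler S- or T-number) TRANSFERS through rational approximations p/q → ℓ of Liouville
quality: if G(θ, ℓ) = 0 then the specialised
integer polynomial G(θ, p/q) is nonzero, has length ≤ C_q·q^K and value ≤ M·q^(−m) for every m,
contradicting the measure; so every Liouville
number is algebraically free from every measured number (node:
`algebraicIndependent_of_polyMeasure_liouville`, ONE schema), and for a REAL
measured t complex conjugation fixes ℚ(t), so t is free from every w with a Liouville real or
imaginary part
(`algebraicIndependent_real_polyMeasure_of_liouville_coord`). Suppliers: the tree's PROVED
Nesterenko–Waldschmidt 1996 measure of e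
(`NesterenkoWaldschmidt1996_thm_4_2_holds`), PROVED Waldschmidt 1978 Cor 3.9 measure of e^β
(`Waldschmidt1978_cor_3_9_holds`), PROVED and
IMPORTED Nesterenko–Waldschmidt 1996 Thm 2(2) measure of π
(`NesterenkoWaldschmidt1996_thm_2_2_holds` — the π-cells are hypothesis-free) and, in
SEVERAL variables (`MvPolyMeasure`, `algebraicIndependent_option_of_mvPolyMeasure_liouville`), the
PROVED Ably 1994 quantitative Lindemann–Weierstrass
(`Ably1994_lindemannWeierstrass_measure_holds`; gives the cells (ℓ, y₁, …, yₙ), (w, y) at EVERY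
level), plus Waldschmidt1978 Cor 3.7 (log α, Cijsouw) as
a vendored hypothesis (cite request). In print this is Mahler's classification
(Mahler 1932; Baker1975 Thm 8.1: algebraically dependent numbers lie in one class; Liouville numbers
are U, e/e^β/π/log α are S or T) and
Kumar–Thangadurai–Waldschmidt arXiv:1312.7154 (Thm 1, §4: Schanuel with trdeg ≥ n+1 at (ℓ, ℓ², …)
for G_δ-dense many Liouville ℓ). Imported area:
metric Diophantine approximation / Mahler classes / Baire category (Mathlib `Liouville`,
`LiouvilleWith`, residual sets). What it does that the
tree's prior Liouville material does not (route-Schanuel-DiophantineDichotomy and its Theorems use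
Liouville points as REFUTATION WITNESSES of
measure-shaped cruxes; closed card liouville-diophantine-dichotomy cuts by joint algebraic
approximability of the point (z, e^z)): this line
cuts by what lies IN THE SPAN, is exact, proves the cells positively for EVERY Liouville coordinate,
and certifies the residual non-summit under
padding while shrinking it strictly from round 1 (kernel `residual_shrinks`: (1, ℓ(1+i)) left the
residual and is decided).

RANKED CRUXES. ROUND 3: r2 CoordLiouvilleSchanuel 31077 (unchanged) · r3 StrictDiophantineSchanuel
31078 = SPLIT PARENT (claimable at low priority) · r4 → LinLiouvilleSchanuel 31986 (A₃, NEW: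
Schanuel at every ℚ-free z that is Liouville as a linear form; WEAKER (kernel S → A₃; (1, iπ) ∉
scope hypothesis-free) · ATTACKABLE (decided (π, ℓπ), (iπ, ℓiπ) for every Liouville ℓ
HYPOTHESIS-FREE; cells through e^β / log α / 1 mod W, W78, NW; level 1 vacuous; level 2 ⟺
DarkLiouvillePairSchanuel mod W/W78) · IDEA-NEEDED at the dark pairs (leaf ExpCurveMahler); why it
might fail: false iff Schanuel fails at a ℚ-free tuple with Liouville-small integer forms, e.g. (Ω,
ρΩ), Ωe^Ω = 1, ρ Liouville — extraction needs a length-POLYNOMIAL measure of some element of ℚ(z,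
e^z), and at points of y·e^y = 1 only exp(−c(log H)²) (NW 1996 Thm 1) is in print
[NesterenkoPhilippon2001, arXiv:math/0312440, Baker1975, Schmidt1980, arXiv:math/0002047,
arXiv:1312.7154, Waldschmidt1978]) · r5 → PolyDiophantineSchanuel 31987 (B₃, NEW DECLARED RESIDUAL ⊊
S_D′: ℚ-free z, no Liouville coordinate in the span, ¬LinLiouville; UNDECIDED · summit-type (∋ (1,
iπ), (iπ, π) hypothesis-free, (1, e) mod NW) · ⊆ T.H. · ⟸ 3816 (kernel) · BARRIER(B1, B2, B4–B6);
why it might fail: false iff Schanuel fails at a Diophantine tuple — e.g. e and π algebraically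
dependent, or e^e algebraic [Waldschmidt2000, Baker1975, NesterenkoPhilippon2001,
arXiv:math/0312440, Lang1966]) · glue StrictDiophantineSchanuelGlue 31988 (support, PROVED in the
node; port ready) · Assembly 31079 (aside). Earlier — #2 CoordLiouvilleSchanuel (crux) — S_L′ — for
every ℚ-linearly independent z : Fin n → ℂ whose ℚ-span contains a number with a Liouville real or
imaginary part, trdeg ℚ(z, e^z) ≥ n. Kernel rungs in the node file: level 1; the level-2 storey
«real measured number × Liouville coordinate» — (π, w), (iπ, w) HYPOTHESIS-FREE (tree-proved NW Thm
2(2), imported), (1, w) mod NW Thm 4.2 (tree-proved), (β, w) β real algebraic mod W78 Cor 3.9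
(tree-proved), (λ, w) λ real log of an algebraic mod W78 Cor 3.7 (cite) — the axis cells (β, ℓ), (β,
ℓ i), (λ, ℓ), (λ, ℓ i) for complex β, λ; and AT EVERY LEVEL n+1 the Lindemann–Weierstrass storey (ℓ,
y₁, …, yₙ), (ℓ i, y), (w, y) with y ∈ ℚ̄ⁿ ℚ-free (real in the last), mod Ably 1994 (tree-proved);
S_L′ ⟹ LiouvilleSchanuel ⟹ DefectOneSchanuel 25020. TAG (crit-1 N2, VERDICT 08:26:56Z, applied):
ATTACKABLE-shallow — in every decided cell the exponential of the Liouville coordinate is NOT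
load-bearing (the bound = a MEASURED algebraically independent (n−1)-subfamily of {z, e^z} + «a
Liouville number is algebraically free from any measured family» (+1)); IDEA-NEEDED core = every
cell where e^ℓ must contribute: first open cells (ℓ, ℓ²) (KTW §4 verbatim), (1, ℓ, ℓ′), (β ∉ ℝ, w
mixed), (ℓ, ℓ′ i), (π, β, w); «e^ℓ transcendental for Liouville ℓ» is open. [difficulty:
open-problem] (why it might fail: false iff Schanuel fails at a ℚ-free tuple whose span has a
Liouville coordinate, e.g. e^ℓ, e^{ℓ²} algebraically dependent over ℚ(ℓ) for a Liouville ℓ;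
extraction needs a length-polynomial measure of the OTHER coordinates, in print only for e, e^β, π,
log α) [arXiv:1312.7154, Baker1975, Waldschmidt1978, NesterenkoWaldschmidt1996, Waldschmidt2000]
#3 StrictDiophantineSchanuel (crux) — S_D′ (DECLARED RESIDUAL) — for every ℚ-linearly independent z
: Fin n → ℂ no element of whose ℚ-span has a Liouville real or imaginary part, trdeg ℚ(z, e^z) ≥ n.
Implied by round 1's DiophantineSchanuel and strictly smaller in scope ((1, ℓ(1+i)) left, kernel
`residual_shrinks`); contains every flagship tuple with kernel-decided membership ((1, e) mod NW;
(1, iπ), (iπ, π) hypothesis-free via `not_liouville_pi` from the imported tree measure); is where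
B1–B6/H3 live; not transportable onto S_L′ by padding. [difficulty: open-problem] (why it might
fail: false iff Schanuel fails at a tuple no span element of which has a Liouville coordinate — e.g.
an algebraic relation between e and π, or e^e algebraic: the textbook open problems (Waldschmidt
2000 §1.4, Baker 1975 Ch. 12); no method in sight beyond B1/B5 scopes) [Waldschmidt2000, Baker1975,
Lang1966, arXiv:1312.7154]
ROUND 4 (flat cone, rev 5/6): rank 2 CoordLiouvilleSchanuel (31077) · rank 4 HyperLiouvilleSchanuel
(33363; birth skeleton SHIPPED g9/bc/birth_section_A4h.lean: S1ʷ stub_weakMeasuredExtraction (levels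
≤ 2 PROVED, LW storey proved, size L) + S2ʷ stub_darkHyper (level ≤ 1 vacuous, level 2 ⟸ leaves
W/W78/NW/DarkWeakMeasure), HyperLiouvilleSchanuel_of kernel, stub probes 2/2 CLEAN) · rank 5
FiniteOrderLiouvilleSchanuel (33364; residual of the Liouville sector, bc5 plan-only: stub
«AlgebraicIndependent ℚ ![ℓ_b, e^{ℓ_b}]» via a sum-form approximation measure ⇒
sb_liouvilleNumber_sq_of_algebraicIndependent) · rank 302 PolyDiophantineSchanuel (31987, declared
residual); asides S_D′ 31078 and A₃ 31986 (retained: A₃ ⟺ A₄ʰ ∧ A₄ᵈ, S_D′ ⟸ A₄ʰ ∧ A₄ᵈ ∧ B₃, kernel),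
support 31988 proved (p768791).

TWO-LAYER PLAN. ROUND 3: split (ii) of the round-2 plan is now FILED in its round-3 form (S_D′ ⟸ A₃
∧ B₃, glue proved); under D-0019 both children are LAYER 2, so a round 4 cannot `--split` B₃ again
without promoting it (PATH A′ then) — acceptable: B₃ lies inside (T.H.) where every catalogued
barrier applies and nothing in sight splits it honestly except DiophantineCore's own 3815/3816 line
(a separate route sharing the edge 3816 → B₃, not a third layer here); A₃'s own exact cut Measured |
Dark (S1 stub_measuredExtraction, S2 stub_dark) is a registered-skeleton matter (g8/bc/), not items.
Earlier — Foreseen glued splits, none filed now (D-0019): (i) S_L′ ⇐ LiouvilleSchanuel →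
MixedLiouvilleSchanuel → S_L′ — PROVED in the node file
(`coordLiouvilleSchanuel_iff_split`, `closes₃`); LiouvilleSchanuel = round 1's crux (axis-Liouville
point ℓ or ℓ·i in the span; text verbatim in
the node file §1), MixedLiouvilleSchanuel = the tuples with a Liouville coordinate but no
axis-Liouville point (e.g. (β, ℓ(1+i)), β ∉ ℝ); file it
with `--split CoordLiouvilleSchanuel --into LiouvilleSchanuel MixedLiouvilleSchanuel --glue
'LiouvilleSchanuel → MixedLiouvilleSchanuel →
CoordLiouvilleSchanuel'` when a prover wants the axis class alone. (ii) inside either child, by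
approximation strength vs. available measure:
cells close as length-polynomial measures arrive (done: e, e^β, π, log α against plain Liouville;
next: measures exp(−c(d)(log H)^κ), κ > 1 —
e.g. Philippon–Waldschmidt simultaneous measures for (β, e^β)-type pairs — against STRONG Liouville
numbers Σ 10^{−k!^2}). (iii) S_D′ ⇐
DefectOneSchanuel 25020 → TightStrictDiophantine → S_D′ (the cell's S⁻ + saturated-residual move
restricted to strict Diophantine tuples), only if
the census shows the Diophantine flagship cells want it. The node records S_L′ → DefectOneSchanuel
(kernel), so a prover closing S_L′ closes 25020.

KILL CRITERIA. ROUND 3: a refutation of LinLiouvilleSchanuel or of PolyDiophantineSchanuel refutes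
Schanuel itself (both S-implied, kernel); the cut is MOOTED if a tribunal certifies A₃ ⟹ S or B₃ ⟹ S
cheaply (bc7 P5 CLEAN for both; fail-alone worlds: Schanuel false only at (1, iπ) leaves A₃ true,
false only at (x, ℓx)-type tuples leaves B₃ true); idle (score 0) if the decided (π, ℓπ) family were
inside S's known regime — it is not (no theorem in print or tree decides Schanuel at (π, ℓπ) as
such). Earlier — A refutation of CoordLiouvilleSchanuel (a ℚ-free tuple with a Liouville coordinate
in its span and trdeg ℚ(z, e^z) < n — e.g. a Liouville ℓ
with e^ℓ and e^(ℓ²) algebraically dependent over ℚ(ℓ)) refutes Schanuel itself (S ⟹ S_L′, kernel),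
so it closes the summit negatively, not just
the route. The route is closed `refuted:CoordLiouvilleSchanuel` /
`refuted:StrictDiophantineSchanuel` on either; it is closed `superseded` if a
route proves Schanuel at all tuples of a class containing every span with a Liouville coordinate
(RealSchanuel-type pieces do NOT); it pivots to
split (ii) of the two-layer plan if S_L′ at the cell (ℓ, ℓ²) is shown to need a measure for e^ℓ that
is provably unavailable.
ROUND 4: a ℚ-free tuple with hyper-Liouville integer forms and trdeg < n kills A₄ʰ (and Schanuel) —
first informative place: the dark hyper pairs (t, ρt), t and e^t transcendental and algebraically
dependent; A₄ᵈ dies with a finite-order Liouville tuple of small trdeg, first candidate (ℓ_b, ℓ_b²)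
— either outcome decides a cell open since Lang 1966.

NOT DECOMPOSED YET. ROUND 3: A₃ is left whole at route level (its exact cut Measured | Dark is the
BC3 skeleton: S1 provable size L, S2 = the dark pairs, IDEA-NEEDED leaf ExpCurveMahler); B₃ is the
declared residual, not cut (its first edge 3816 → B₃ is kernel; B₃ ⟺ 3816 ∧ … would be a round-4
forest merge, standing F2″-1K (β)); n ≥ 3 storeys of A₃ (LW/Baker relative extraction over ℚ̄(y),
norm trick) are prover targets, not items. Earlier — The approximation-strength sub-cells of S_L′
(which order of Liouville-ness beats which measure shape), the U_d-thickening of the cut (span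
elements VERY WELL approximable by algebraic numbers of bounded degree — Mahler U-numbers of higher
index; would enlarge S_L′ again, needs
number-field heights), and the strict Diophantine residual's own carving (B1 scope 𝓛, B5 scope, dark
complement — done for the axis class in
route 1G rounds 3–4 and deliberately not repeated here) are layer-2 material. DefectOneSchanuel and
LiouvilleSchanuel are by-name consequences
of S_L′, not items of this route.
ROUND 4: A₄ʰ's level-2 leaf DarkWeakMeasure (≈ 500 l bookkeeping from NW 1996 Thm 1:
root-closeness/resultant) and the level ≥ 3 simultaneous weak measures (S1ʷ WeakMeasuredExtraction)
are prover-side under the birth skeleton; A₄ᵈ and B₃ are NOT decomposed. STANDING F2‴-1K (critic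
13:33:07Z): the next accepted movement is DarkWeakMeasure landed (A₄ʰ[n ≤ 2] a theorem mod W, W78,
NW), or a decided cell / certified member inside A₄ᵈ or B₃ proper, or S1ʷ at level 3 — not a further
predicate carving of A₄ᵈ/B₃ without a NEW decided cell, not an existential-only shrink.

CHEAPEST FALSIFIER. ROUND 3: lookup — a theorem or counterexample in print on Schanuel / algebraic
independence at pairs (t, ρt) with ρ Liouville and t, e^t algebraically dependent (e.g. Ωe^Ω = 1),
or a polynomial transcendence measure at transcendental points of algebraic curves through the graph
of exp (would turn the dark locus into a rung); ran (lens, g8/NODE-g8.md §5): lit vsearch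
«Schanuel's conjecture for pairs (t, ρt) with ρ a Liouville number» k 8 → class-level only (Baker
1975 pp.82–87/138, Chudnovsky 1984, LNM 1752 p.248); lit search --hybrid «technical hypothesis
measure linear independence» → LNM 1752 p.248 only; galaxy «technical hypothesis|measure of linear
independence|Liouville point» --star all → 24 rows, none on-topic. Earlier — Lookup: is there a
Liouville number ℓ and an integer relation between e^ℓ and e^(ℓ²) over ℚ(ℓ) in print, or a theorem
«e^ℓ transcendental
for every Liouville ℓ» that would make the first open cell a rung? Ran: lit search --hybrid
"Liouville number exponential algebraic
independence Schanuel" (8 hits; arXiv:1312.7154 Thm 1 gives G_δ-dense EXISTENCE only, no statement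
for a given ℓ), lit galaxy search
"Liouville number|U-number" --star all (hits are Mahler-class texts: e^ℓ for Liouville ℓ is not
known transcendental in general — LeVeque
Topics Vol. 2 Ch. 5, Baker1975 Ch. 8). In-Lean: the storey compiles (rc 0, 0 sorry),
`residual_shrinks` exhibits a tuple in S_L′ ∖ S_L decided
by the node and `not_coordLiouvilleSpan_one_e` a flagship in S_D′, so the cut is vacuous on neither
side.
ROUND 4: land DarkWeakMeasure — if the conversion of a small |P(t)| at an exp-algebraic t into
algebraic (α, β) close to (t, e^t) with degree/height control fails to yield a WEAK (finite-type)
measure from NW 1996 Thm 1, A₄ʰ's ATTACKABLE tag drops to «level 2 open»; conversely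
`HyperLiouvilleSchanuel[n ≤ 2]` becomes a theorem mod registered facts.

NUMBERS. ROUND 3: kernel (node §§11–13): ¬LinLiouville ⟹ ‖Σ gᵢzᵢ‖ ≥ 2^{−ω}(Σ|gᵢ|)^{−ω} ⟹ T.H.;
LinLiouville ℚ-free pair ⟺ z₁ = ρz₀, ρ real Liouville (exponent bookkeeping (1+S)^{2m+c}); decided
hypothesis-free: 2 ≤ trdeg ℚ(π, ℓπ, e^π, e^(ℓπ)) and 2 ≤ trdeg ℚ(iπ, ℓiπ, e^(iπ), e^(ℓiπ)) for every
Liouville ℓ; residual cell test: B₃ at (1, iπ) ⟺ e ⫫ π; level-2 reduction A₃|₂ ⟺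
DarkLiouvillePairSchanuel mod W (Waldschmidt1978 Cor 3.9, tree-proved) / W78 Cor 3.7 (cite-request
wi-97874). Earlier — NW 1996 Thm 4.2 (tree, proved): |P(e)| ≥ exp(−1.3·10^5 · d² · (log L + d)), P ∈
ℤ[X] nonzero, deg ≤ d, length ≤ L, L ≥ 3 — polynomial in
log L. Waldschmidt1978 Cor 3.9 (tree, proved): |P(e^β)| ≥ exp(−C(β) N² (log H + log N)(log log H +
log N)²/(log log H + log max(1, log N))²)
for N ≥ 1, H ≥ 16 — the node bounds the fraction by (1 + log N)² and obtains 1 ≤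
e^B·17^τ·len^τ·|P(e^β)| with τ = ⌈C N²(1+log N)²⌉.
NW 1996 Thm 2(2) (tree, proved, imported): |P(π)| ≥ exp(−2·10^6 d (log L + d log d)(1 + log d)), L ≥
3. Ably 1994 (tree, proved): |P(e^{y_1}, …,
e^{y_n})| ≥ exp(−c₂ Dⁿ (log H + exp(C Dⁿ log(D+1)))) for ℚ-free algebraic y, P ∈ ℤ[X₁..Xₙ]∖0 of
total degree ≤ D and height ≤ H — polynomial in H at
fixed D, which is all the extraction uses. W78 Cor 3.2 (π, alternative): exp(−2^40 N (log H + N log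
N)(1 + log N)), N ≥ 2, H ≥ 16 (p. 452); Cor 3.7
(log α): exp(−C N² (log H + N log N)(1 + log N)^{−1}), N ≥ 1, H ≥ 16 (p. 454). Any measure
exp(−c(d)·log H) works against plain Liouville numbers; exp(−c(d)(log H)^κ), κ > 1, needs
approximation
|ℓ − p/q| < exp(−(log q)^{κ+ε}). Irrationality exponent of π ≤ 7.103205334138
(ZeilbergerZudilin2020) — any finite exponent suffices here.

DEFINITION REQUESTS. None: `Liouville`, `LiouvilleWith`, `Submodule.span`, `Algebra.trdeg`,
`IntermediateField.adjoin`, `Complex.re/im` are Mathlib; the NW and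
W78 Cor 3.9 and Ably 1994 measures are Literature named facts PROVED in the tree
(`NesterenkoWaldschmidt1996_thm_4_2`, `Waldschmidt1978_cor_3_9`,
`Ably1994_lindemannWeierstrass_measure`); their modules are not built on the check farm tonight, so
the node carries them as hypotheses with VERBATIM
texts, discharged by name (`_holds`) once built; the π measure `NesterenkoWaldschmidt1996_thm_2_2`
IS built and is imported and applied (hypothesis-free
π-cells). Cite fact wanted (filed as a cite workitem): Waldschmidt1978 Cor 3.7 (measure of a
non-zero logarithm of an algebraic number, p. 454;
Cijsouw) as a named fact under Literature/NumberTheory/Transcendental (node def `W78LogMeasure` is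
the proposed text; `W78PiMeasure` = Cor 3.2 is
kept only as an alternative supplier and needs no fact).

Novelty: ROUND 4 (lens-6 g9 «HyperCarving», log g9/NODE-g9.md §5, corpus fts+vec AND galaxy, 2026-08-30): A₃
LinLiouvilleSchanuel is cut by the ORDER of the Liouville smallness of the tuple's integer forms —
HyperLiouvilleSchanuel (A₄ʰ: forms small to EVERY exponential order exp(−H^m)) vs
FiniteOrderLiouvilleSchanuel (A₄ᵈ: Liouville to every polynomial order, not hyper). Nearest print
for the OBJECT «hyper-Liouville number / form of infinite exponential order»: LeVeque strong/weak
Liouville numbers, Alniaçik semi-strong U_m-numbers, Petruska 1992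
[corpus:book:bugeaud2004-approximation-by-algebraic-numbers p.170]; Schleischitz 2024 exact
approximation orders [galaxy:pdf:2283329348782681200]; LNM 1752 Ch. 14–15 measures of finite
exponential order [galaxy:panama:514519902191626]. Queries run (both corpora): "strong Liouville
number", "super Liouville|ultra-Liouville|hyper-Liouville", "Liouville number algebraic independence
exponential", "transcendence type Liouville algebraically independent", "approximation measure
exponential rational point sum of heights" — no hit states «ρ hyper-Liouville ⇒ ρ algebraically
independent of every θ with a weak (finite-type) measure» as a theorem about exp's values;
folklore-adjacent (Lang 1966 transcendence types; LNM 1752 Ch. 3 φ-measures; Mahler classes). The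
(H) bridge uses the REGISTERED fact NesterenkoWaldschmidt1996_thm_5_1
[corpus:paper:arxiv-math_0002047 p.2 Thm 5(1)]; the leaf DarkWeakMeasure is NW 1996 Thm 1
[corpus:paper:arxiv-math_0002047  [refs: 10.1016/j.jnt.2015.02.017, 1312.7154, book:bugeaud2004-approximation-by-algebraic-numbers, paper:arxiv-math_0002047, paper:arxiv-math_0312440, book:nesterenko2001, book:chudnovsky1984, paper-arxiv-1312.7154, book-baker1975, paper-waldschmidt1978, doi:10.1016/j.jnt.2015.02.017]

Barriers (technique_class: liouville-extraction, order carving, weak measures): - technique_class: liouville-extraction, order carving, weak measures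
- Literature.Barriers.Schanuel.LargeTranscendenceDegree (B3: auxiliary-function criteria under the
Technical Hypothesis stop at trdeg ≈ dℓ/(ℓ+d)): CoordLiouvilleSchanuel, LinLiouvilleSchanuel and
HyperLiouvilleSchanuel sit OUTSIDE — every A₄ʰ tuple violates the T.H. at EVERY order (‖Σhᵢzᵢ‖ <
exp(−H^m) ∀ m), where the Gelfond–Philippon–Diaz method is void by its own hypothesis
[corpus:book:nesterenko2001 p.248 Def 2.6, p.249 L27]; the lever is extraction (a hyper-Liouville ρ
is algebraically independent of any θ with a weak measure |P(θ)| ≥ exp(−C_d·len^{k_d}); kernel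
no_int_relation_of_mvWeakMeasure_hyperLiouville) — no auxiliary function in ρ, output not bounded by
the dℓ/(ℓ+d) count (full trdeg on the decided cells). FiniteOrderLiouvilleSchanuel (A₄ᵈ) sits INSIDE
B3's hypothesis at finite order (T.H. holds at some m): residual of the Liouville sector,
IDEA-NEEDED (sum-form approximation measure for e^{p/q}; print has the product form
[corpus:paper:arxiv-math_0002047 p.2 Thm 5(1)], gap stated [corpus:paper:arxiv-math_0312440 p.5]) —
requires new print at its first cell (ℓ_b, ℓ_b²), said so; PolyDiophantineSchanuel (B₃, declared
residual) INSIDE under the ceiling — not evaded; its first edge is the dormant crux SchanuelUnderTH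
3816 ⟹ B₃ (kernel).
- Literature.Barriers.Schanuel.AlgebraicIndependenceOfLogarithms (B1/B2): outside for S_L′, A₄ʰ, A₄ᵈ
— no logarithms of algebraic numbers are assumed; a ℚ-combinat

History (route lifecycle, newest last):
- 2026-08-30T21:44:51Z · RESIDUAL declared: PolyDiophantineSchanuel (stmt-Schanuel-31987) — summit-strength until shown otherwise: D-0170(1) migration of the docstring tag of record (window-13 schema live 21:33:55Z): B₃ PolyDiophantineSchanuel (stmt-S (planner-decomp-schanuel-writer-1-g13-0)

sub-problem: Schanuel · status: draft · opened planner-decomp-schanuel-writer-1-g5-0 2026-08-30T08:28:17Z · rev 8 · ledger route-Schanuel-RootDecomp1K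
GENERATED by the gate from the ledger (D-0016/17). Provers cite these decls: `theorem foo : Summit.Schanuel.Schanuel.Theses.RootDecomp1K.<Decl> := …` in Summits/Schanuel/Schanuel/Theorems/<Name>.lean.
-/

namespace Summit.Schanuel.Schanuel.Theses.RootDecomp1K

open scoped BigOperators Topology Manifold Classical MeasureTheory ProbabilityTheory Matrix InnerProductSpace ComplexConjugate ContinuousMap
open Filter Set Function TopologicalSpace MeasureTheory

attribute [summit_statement] _root_.Schanuel

open Literature.Periods

/-- item stmt-Schanuel-31077 · crux · leaf ATTACKABLE · rank 2 · open · by planner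
why it might fail: false iff Schanuel fails at a ℚ-free tuple whose span has a Liouville coordinate, e.g. e^ℓ, e^{ℓ²} algebraically dependent over ℚ(ℓ) for a Liouville ℓ; extraction needs a length-polynomial measure of the OTHER coordinates, in print only for e, e^β, π, log α
sources: arXiv:1312.7154, Baker1975, Waldschmidt1978, NesterenkoWaldschmidt1996, Waldschmidt2000
[crux] S_L′ — for every ℚ-linearly independent z : Fin n → ℂ whose ℚ-span contains a number with a
Liouville real or imaginary part, trdeg ℚ(z, e^z) ≥ n. Kernel rungs in the node file: level 1; the
level-2 storey «real measured number × Liouville coordinate» — (π, w), (iπ, w) HYPOTHESIS-FREE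
(tree-proved NW Thm 2(2), imported), (1, w) mod NW Thm 4.2 (tree-proved), (β, w) β real algebraic
mod W78 Cor 3.9 (tree-proved), (λ, w) λ real log of an algebraic mod W78 Cor 3.7 (cite) — the axis
cells (β, ℓ), (β, ℓ i), (λ, ℓ), (λ, ℓ i) for complex β, λ; and AT EVERY LEVEL n+1 the
Lindemann–Weierstrass storey (ℓ, y₁, …, yₙ), (ℓ i, y), (w, y) with y ∈ ℚ̄ⁿ ℚ-free (real in the
last), mod Ably 1994 (tree-proved); S_L′ ⟹ LiouvilleSchanuel ⟹ DefectOneSchanuel 25020. TAG (crit-1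
N2, VERDICT 08:26:56Z, applied): ATTACKABLE-shallow — in every decided cell the exponential of the
Liouville coordinate is NOT load-bearing (the bound = a MEASURED algebraically independent
(n−1)-subfamily of {z, e^z} + «a Liouville number is algebraically free from any measured family»
(+1)); IDEA-NEEDED core = every cell where e^ℓ must contribute: first open cells (ℓ, ℓ²) (KTW §4
verbatim), (1, ℓ, ℓ′), (β ∉ ℝ, w mixed), (ℓ, -/
@[route_item "route-Schanuel-RootDecomp1K", crux (bottleneck := work) (source := "ledger D-0171 leaf tag ATTACKABLE on stmt-Schanuel-31077, 2026-09-01")]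
def CoordLiouvilleSchanuel : Prop :=
  ∀ (n : ℕ) (z : Fin n → ℂ), LinearIndependent ℚ z → (∃ w ∈ Submodule.span ℚ (Set.range z), Liouville w.re ∨ Liouville w.im) → (n : Cardinal) ≤ Algebra.trdeg ℚ ↥(IntermediateField.adjoin ℚ (Set.range z ∪ Set.range (Complex.exp ∘ z)))

/-- item stmt-Schanuel-33363 · crux · leaf ATTACKABLE · rank 4 · open · by planner
why it might fail: false iff Schanuel fails at a ℚ-free tuple with integer forms small to EVERY exponential order, e.g. (Ω, λ_H·Ω), Ωe^Ω=1: level 2 needs a weak measure exp(−C·L^k) at exp-algebraic points (NW1996 Thm 1 gives exp(−cD·log H…) only after an unprinted root-closeness step); n≥3 needs simultaneous ones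
sources: arXiv:math/0002047, NesterenkoPhilippon2001, Waldschmidt1978, Baker1975, Bugeaud2004, arXiv:math/0312440
[crux] A₄ʰ — SCHANUEL AT THE HYPER-LIOUVILLE POINTS OF ℙⁿ⁻¹ (round 4 of lens 6; the cut of A₃ =
LinLiouvilleSchanuel 31986 by ONE predicate of the tuple, filed on the ledger as child 1 of the
RESPLIT of the residual S_D′ = StrictDiophantineSchanuel 31078 into A₄ʰ, A₄ᵈ, B₃): for every
ℚ-linearly independent z : Fin n → ℂ that is HYPER-LIOUVILLE AS A LINEAR FORM — for every m some
non-zero h ∈ ℤⁿ has ‖Σ hᵢzᵢ‖ < exp(−(1 + Σ|hᵢ|)^m) (smallness beating EVERY exponential order, not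
merely every polynomial one) — trdeg ℚ(z, e^z) ≥ n. STRUCTURE (kernel
HOME/decomp-schanuel-lens-6/g9/HyperCarving.lean §17a, 0 sorry): level 1 vacuous
(not_hyperLinLiouville_one); a ℚ-free pair is hyper-Liouville as a form iff z₁ = ρ·z₀ with ρ a real
HYPER-LIOUVILLE number, |ρ − p/q| < exp(−q^m) for every m (hyperLinLiouville_pair_iff); such ρ are
dense-G_δ (dense_setOf_hyperLiouville, gen 8) and an EXPLICIT one is certified: λ_H = Σ_k 2^{−a_k},
a₀ = 1, a_{k+1} = 2^{(k+1)a_k} (hyperLiouville_lambdaH, §17d); Liouville's constants ℓ_b = Σ b^{−k!}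
are NOT hyper-Liouville (not_hyperLiouville_liouvilleNumber, §17e). LEVER = why A₄ʰ is strictly MORE
ATTACKABLE than A₃ (§17h/§17k, 0 sorry): a hyper-Liouville ρ is alg -/
@[route_item "route-Schanuel-RootDecomp1K", crux (bottleneck := work) (source := "ledger D-0171 leaf tag ATTACKABLE on stmt-Schanuel-33363, 2026-09-01")]
def HyperLiouvilleSchanuel : Prop :=
  ∀ (n : ℕ) (z : Fin n → ℂ), LinearIndependent ℚ z → (∀ m : ℕ, ∃ h : Fin n → ℤ, h ≠ 0 ∧ ‖∑ i, (h i : ℂ) * z i‖ < Real.exp (-((1 + ∑ i, (|h i| : ℝ)) ^ m))) → (n : Cardinal) ≤ Algebra.trdeg ℚ ↥(IntermediateField.adjoin ℚ (Set.range z ∪ Set.range (Complex.exp ∘ z)))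

/-- item stmt-Schanuel-33364 · crux · rank 5 · open · by planner
why it might fail: false iff Schanuel fails at a Liouville-but-not-hyper point, first open cell (ℓ_b, ℓ_b²), ℓ_b = Σ b^{−k!}: deciding it needs |e^{p/q} − α| ≥ (qH)^{−c(n)} with heights as a SUM; print (NW1996 Thm 5, Waldschmidt 2000 §3) has the product log a·log b, losing by k!·log b — open since Lang 1966
sources: arXiv:math/0312440, arXiv:math/0002047, Lang1966, Waldschmidt2000, NesterenkoPhilippon2001, Baker1975
[crux] A₄ᵈ — SCHANUEL AT THE LIOUVILLE POINTS OF FINITE EXPONENTIAL ORDER (round 4 of lens 6; THE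
RESIDUAL OF A₃ = LinLiouvilleSchanuel 31986, child 2 of the resplit of S_D′ 31078): for every
ℚ-linearly independent z : Fin n → ℂ that IS Liouville as a linear form (for every ω some h ≠ 0 with
‖Σ hᵢzᵢ‖ < (1 + Σ|hᵢ|)^{−ω}) but is NOT hyper-Liouville as a form (for some m every h ≠ 0 has ‖Σ
hᵢzᵢ‖ ≥ exp(−(1 + Σ|hᵢ|)^m)), trdeg ℚ(z, e^z) ≥ n. GLUE (kernel
HOME/decomp-schanuel-lens-6/g9/HyperCarving.lean §17f, and g9/glue_test.lean over the LIVE route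
file rev 4, rc 0 · axioms std): A₄ʰ → A₄ᵈ → A₃ (linLiouvilleSchanuel_of_pieces₄, excluded middle on
«hyper-Liouville as a form»), EXACT (linLiouvilleSchanuel_iff_pieces₄ : A₃ ↔ A₄ʰ ∧ A₄ᵈ), hence A₄ʰ →
A₄ᵈ → B₃ → S_D′ (strictDiophantineSchanuelHyperGlue_holds; = the round-3 glue 31988 ∘ pieces₄) and
closes₅ : S_L′ → A₄ʰ → A₄ᵈ → B₃ → Schanuel through the live 2-binder closes, schanuel_iff_pieces₄
exact. NAMED FIRST OPEN CELL (hypothesis-free kernel certificate liouvilleNumber_sq_cell, §17g):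
(ℓ_b, ℓ_b²) with ℓ_b = liouvilleNumber b = Σ_k b^{−k!}, b ≥ 2 (Liouville's constant for b = 10) —
ℚ-free, a Liouville coordinate (scope of 31077 too), Lin -/
@[route_item "route-Schanuel-RootDecomp1K", crux (bottleneck := idea) (source := "ledger D-0171 leaf tag IDEA-NEEDED on stmt-Schanuel-33364, 2026-09-01")]
def FiniteOrderLiouvilleSchanuel : Prop :=
  ∀ (n : ℕ) (z : Fin n → ℂ), LinearIndependent ℚ z → (∀ ω : ℕ, ∃ h : Fin n → ℤ, h ≠ 0 ∧ ‖∑ i, (h i : ℂ) * z i‖ < 1 / (1 + ∑ i, (|h i| : ℝ)) ^ ω) → (¬ ∀ m : ℕ, ∃ h : Fin n → ℤ, h ≠ 0 ∧ ‖∑ i, (h i : ℂ) * z i‖ < Real.exp (-((1 + ∑ i, (|h i| : ℝ)) ^ m))) → (n : Cardinal) ≤ Algebra.trdeg ℚ ↥(IntermediateField.adjoin ℚ (Set.range z ∪ Set.range (Complex.exp ∘ z)))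

/-- item stmt-Schanuel-31078 · aside · rank 3 · SPLIT (gen 1) into LinLiouvilleSchanuel, PolyDiophantineSchanuel + glue StrictDiophantineSchanuelGlue · direct attempts still welcome (low priority) · by planner
why it might fail: false iff Schanuel fails at a tuple no span element of which has a Liouville coordinate — e.g. an algebraic relation between e and π, or e^e algebraic: the textbook open problems (Waldschmidt 2000 §1.4, Baker 1975 Ch. 12); no method in sight beyond B1/B5 scopes
sources: Waldschmidt2000, Baker1975, Lang1966, arXiv:1312.7154
[crux] S_D′ (DECLARED RESIDUAL) — for every ℚ-linearly independent z : Fin n → ℂ no element of whose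
ℚ-span has a Liouville real or imaginary part, trdeg ℚ(z, e^z) ≥ n. Implied by round 1's
DiophantineSchanuel and strictly smaller in scope ((1, ℓ(1+i)) left, kernel `residual_shrinks`);
contains every flagship tuple with kernel-decided membership ((1, e) mod NW; (1, iπ), (iπ, π)
hypothesis-free via `not_liouville_pi` from the imported tree measure); is where B1–B6/H3 live; not
transportable onto S_L′ by padding. [difficulty: open-problem] -/
@[route_item "route-Schanuel-RootDecomp1K", crux]
def StrictDiophantineSchanuel : Prop :=
  ∀ (n : ℕ) (z : Fin n → ℂ), LinearIndependent ℚ z → (¬ ∃ w ∈ Submodule.span ℚ (Set.range z), Liouville w.re ∨ Liouville w.im) → (n : Cardinal) ≤ Algebra.trdeg ℚ ↥(IntermediateField.adjoin ℚ (Set.range z ∪ Set.range (Complex.exp ∘ z)))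

-- parent: StrictDiophantineSchanuel · child (gen 1)
/--     item stmt-Schanuel-31987 · crux · RESIDUAL (gen 0; summit-strength until shown otherwise, D-0170) · rank 302 · open
    parent: StrictDiophantineSchanuel · by planner
    why it might fail: false iff Schanuel fails at a Diophantine tuple (no Liouville coordinate in the span, polynomial linear-independence measure) — e.g. e and π algebraically dependent, or e^e algebraic: the textbook open problems (Waldschmidt 2000 §1.4, Baker 1975 Ch. 12); only B1/B5-scope methods act here
    sources: Waldschmidt2000, Baker1975, NesterenkoPhilippon2001, arXiv:math/0312440, Lang1966
[crux] B₃ — SCHANUEL ON THE POLYNOMIAL-DIOPHANTINE SECTOR (the NEW DECLARED RESIDUAL, round 3; child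
2 of the split of StrictDiophantineSchanuel 31078): for every ℚ-linearly independent z : Fin n → ℂ
NO element of whose ℚ-span has a Liouville real or imaginary part AND which is NOT Liouville as a
linear form (i.e. carries a POLYNOMIAL measure of linear independence: some ω with ‖Σ hᵢzᵢ‖ ≥ (1 +
Σ|hᵢ|)^{−ω} for all h ≠ 0), trdeg ℚ(z, e^z) ≥ n. GLUE (kernel strictDiophantineSchanuel_of_pieces₃,
excluded middle on LinLiouville z): A₃ → B₃ → S_D′; node closes₄ : CoordLiouvilleSchanuel → A₃ → B₃
→ Schanuel, EXACT (schanuel_iff_pieces₃; S_D′ ⟺ (A₃ ∩ scope S_D′) ∧ B₃,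
strictDiophantineSchanuel_iff_pieces₃). NESTED and STRICTLY SMALLER than S_D′ (kernel
residual_shrinks₃: for every Liouville ℓ a ℚ-free pair (x, ℓx) with NO Liouville coordinate in its
span — filed under S_D′ by round 2 — IS LinLiouville, so round 3 files it under A₃; existence by
Lebesgue measure, Mathlib volume_setOf_liouville: a.e. real x works; no explicit such x is
certifiable, the Liouville status of e.g. π(a+bℓ) being unknown). POSITION W.R.T. THE BARRIERS:
every tuple in B₃'s scope SATISFIES barrier B3's Technical Hyp -/
@[route_item "route-Schanuel-RootDecomp1K", crux]
def PolyDiophantineSchanuel : Prop :=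
  ∀ (n : ℕ) (z : Fin n → ℂ), LinearIndependent ℚ z → (¬ ∃ w ∈ Submodule.span ℚ (Set.range z), Liouville w.re ∨ Liouville w.im) → (¬ ∀ ω : ℕ, ∃ h : Fin n → ℤ, h ≠ 0 ∧ ‖∑ i, (h i : ℂ) * z i‖ < 1 / (1 + ∑ i, (|h i| : ℝ)) ^ ω) → (n : Cardinal) ≤ Algebra.trdeg ℚ ↥(IntermediateField.adjoin ℚ (Set.range z ∪ Set.range (Complex.exp ∘ z)))

-- parent: StrictDiophantineSchanuel · child (gen 1)
/--     item stmt-Schanuel-31986 · aside · rank 301 · open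
    parent: StrictDiophantineSchanuel · by planner
    why it might fail: false iff Schanuel fails at a ℚ-free tuple with Liouville-small integer forms, e.g. (Ω, ρΩ), Ωe^Ω = 1, ρ Liouville: extraction needs a length-POLYNOMIAL measure of some element of ℚ(z,e^z); at points of y·e^y = 1 only exp(−c(log H)²) (NW 1996 Thm 1) is in print
    sources: NesterenkoPhilippon2001, arXiv:math/0312440, Baker1975, Schmidt1980, arXiv:math/0002047, arXiv:1312.7154
[crux] A₃ — SCHANUEL AT THE LIOUVILLE POINTS OF ℙⁿ⁻¹ (round 3 of lens 6, child 1 of the split of the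
residual S_D′ = StrictDiophantineSchanuel 31078): for every ℚ-linearly independent z : Fin n → ℂ
that is LIOUVILLE AS A LINEAR FORM — for every ω some non-zero h ∈ ℤⁿ has ‖Σ hᵢzᵢ‖ < (1 +
Σ|hᵢ|)^{−ω} — trdeg ℚ(z, e^z) ≥ n. This is the cut along barrier B3's own fault line: the
large-transcendence-degree method (Gel'fond–Philippon–Diaz, LNM 1752 Ch. 14 Def. 2.6/Thm 2.7;
dormant route DiophantineCore, stmt-Schanuel-3815–3817) ENTERS through the Technical Hypothesis ‖Σ
hᵢzᵢ‖ ≥ exp(−H^ε) and is void off it; KERNEL (HOME/decomp-schanuel-lens-6/g8/LiouvilleCarving.lean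
§11, 0 sorry): ¬LinLiouville z → TechnicalHypothesis z (via the tree-PROVED
TechnicalHypothesis.of_lowerBound, DiazGrid), hence LinLiouville z ∨ T.H.(z) for EVERY tuple — A₃'s
scope CONTAINS the complement of B3's hypothesis («the set on which no tool acts», DiophantineCore
header) by construction, and A₃ together with the dormant crux SchanuelUnderTH 3816 already gives
Schanuel (kernel schanuel_of_linLiouville_of_underTH). STRUCTURE (kernel §11b): a ℚ-free pair is
LinLiouville iff z₁ = ρ·z₀ with ρ a REAL LIOUVILLE number (e -/
@[route_item "route-Schanuel-RootDecomp1K", crux]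
def LinLiouvilleSchanuel : Prop :=
  ∀ (n : ℕ) (z : Fin n → ℂ), LinearIndependent ℚ z → (∀ ω : ℕ, ∃ h : Fin n → ℤ, h ≠ 0 ∧ ‖∑ i, (h i : ℂ) * z i‖ < 1 / (1 + ∑ i, (|h i| : ℝ)) ^ ω) → (n : Cardinal) ≤ Algebra.trdeg ℚ ↥(IntermediateField.adjoin ℚ (Set.range z ∪ Set.range (Complex.exp ∘ z)))

-- parent: StrictDiophantineSchanuel · glue (gen 1)
/--     item stmt-Schanuel-31988 · support · rank 303 · closed · proved by Summit.Schanuel.Schanuel.Theorems.RootDecomp1KLinLiouvilleSplit.strictDiophantineSchanuelGlue_holds (prover)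
    parent: StrictDiophantineSchanuel · GLUE: children ⟹ parent · by planner
LinLiouvilleSchanuel → PolyDiophantineSchanuel → StrictDiophantineSchanuel -/
@[route_item "route-Schanuel-RootDecomp1K"]
def StrictDiophantineSchanuelGlue : Prop :=
  LinLiouvilleSchanuel → PolyDiophantineSchanuel → StrictDiophantineSchanuel

-- `StrictDiophantineSchanuelGlue` holds: proved by `Summit.Schanuel.Schanuel.Theorems.RootDecomp1KLinLiouvilleSplit.strictDiophantineSchanuelGlue_holds` (its module imports this route file, so no `_holds` link can be stated here).

/-- item stmt-Schanuel-31079 · assembly · rank 1 · open · by planner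
sources: arXiv:1312.7154, Baker1975
[assembly] CoordLiouvilleSchanuel → StrictDiophantineSchanuel → Schanuel (the deciding theorem is
`closes` in glue.g7.lean; `_root_.Schanuel` is the summit decl). -/
@[route_item "route-Schanuel-RootDecomp1K"]
def Assembly : Prop :=
  CoordLiouvilleSchanuel → StrictDiophantineSchanuel → _root_.Schanuel

/-! D-0027 §2.1 — DECIDING THEOREM (planner-authored via `route open/edit --closes-file`; by planner-decomp-schanuel-writer-1-g6-0 2026-08-30T13:33:27Z):
its hypotheses are this route's items and its conclusion the sub-problem Statement (glue_lint), and it elaborates with this file. -/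

@[closes "route-Schanuel-RootDecomp1K"] theorem closes (hL : CoordLiouvilleSchanuel) (hH : HyperLiouvilleSchanuel) (hF : FiniteOrderLiouvilleSchanuel) (hB : PolyDiophantineSchanuel) : _root_.Schanuel := by
  intro n z hz
  by_cases h : ∃ w ∈ Submodule.span ℚ (Set.range z), Liouville w.re ∨ Liouville w.im
  · exact hL n z hz h
  · by_cases hLF : ∀ ω : ℕ, ∃ h : Fin n → ℤ, h ≠ 0 ∧ ‖∑ i, (h i : ℂ) * z i‖ < 1 / (1 + ∑ i, (|h i| : ℝ)) ^ ω
    · by_cases hyp : ∀ m : ℕ, ∃ h : Fin n → ℤ, h ≠ 0 ∧ ‖∑ i, (h i : ℂ) * z i‖ < Real.exp (-((1 + ∑ i, (|h i| : ℝ)) ^ m))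
      · exact hH n z hz hyp
      · exact hF n z hz hLF hyp
    · exact hB n z hz h hLF

end Summit.Schanuel.Schanuel.Theses.RootDecomp1K
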